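import Summits.CriticalPhenomena.SAWScalingLimit.Theses.SAWAsymptoticMorera

/-!
# Birth skeleton (`Lines/birth.lean`) for crux `ObservableLimitFlat` (stmt-CriticalPhenomena-6855)

Route `SAWAsymptoticMorera` of `CriticalPhenomena/SAWScalingLimit`; the crux (rank 0, auto-crux promoted from
the route's target; concluded BY NAME by `ObservableLimitFlat_of`) is the robust `δℤ²` form of
Duminil-Copin–Smirnov 2012 Conjecture 2: there is a universal REAL lattice constant `C ≠ 0` such that for every
Dobrushin domain `(D; a, b)` whose boundary is a horizontal segment near `b` (domain above), every lattice root
`a_δ → a` with outside reference neighbour `a′_δ`, every bottom-row `b_δ → b`, every interior edge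
`(z_δ, w_δ) → z₀ ∈ D` and every conformal `Φ : D → ℍ` with `a ↦ ∞`, `b ↦ 0`, `Φ′ → c ≠ 0` at `b`
(`L` a continuous logarithm of `Φ′/c` with `L → 0` at `b`), the boundary-normalised critical mid-edge
parafermionic observable `(H_δ(z_δ,w_δ) + H_δ(w_δ,z_δ)) / H_δ(b_δ, b_δ − (0,1))` tends to `C · exp((5/8) L z₀)`
`= C · (Φ′(z₀)/c)^{5/8}` as `δ → 0⁺`.

## The line — interior conformal covariance ⊕ flat-boundary matching (the route header's own cut)

The route derives the crux through `BoundaryIdentification := AsymptoticMorera → InteriorRegularity →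
ObservableLimitFlat` (r4), whose informal content has an INTERIOR half (Weyl: subsequential limits of the
normalised observable are holomorphic; the lattice boundary condition `arg F = −(5/8)·normal` passes to the
Riemann–Hilbert condition `Im (f dz^{5/8}) = 0`; index-`5/8` RH uniqueness gives `f = λ (Φ′)^{5/8}`) and a BOUNDARY
half ("the flat environment at `b` fixes the normalisation up to the universal lattice constant `C`",
KennedyLawler2013).  The header's KILL CRITERIA name the interior half as the pivot target: "interior
normalisation `F_δ(z_δ)/F_δ(z′_δ) → (φ′(z)/φ′(z′))^{5/8}`, and move the constant …".  This skeleton types exactly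
that cut, over the route's inlined observable (vocabulary `halfEdge` / `midEdge` / `exitTerm` below = the
`let H` of the crux, letter for letter):

* `stub_interiorCovariance : InteriorCovariance` (research-open; where r2 + r3 enter) — the TWO-POINT INTERIOR form
  of DCS Conjecture 2 on `δℤ²`, free of `b` and of any lattice constant: for every Dobrushin domain, root data as
  in the crux, two interior edge sequences `(z_δ,w_δ) → z₀`, `(z′_δ,w′_δ) → z₀′` and `Φ : D → ℍ` with `a ↦ ∞`
  (`L` any continuous log of `Φ′/c`, `c ≠ 0` a gauge constant),
  `midEdge(z_δ,w_δ) / midEdge(z′_δ,w′_δ) → exp((5/8)(L z₀ − L z₀′)) = (Φ′(z₀)/Φ′(z₀′))^{5/8}`.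
  The root's local lattice factor and the reference-direction phase are COMMON to both edges and cancel, which
  is why no constant appears (KennedyLawler2013's boundary effects sit at `a` only).  On this route it is the
  conclusion of `AsymptoticMorera → InteriorRegularity → ·` by Weyl + RH(5/8) uniqueness (the interior half of
  r4); it is also the common currency of every `ℤ²`-parafermion route.
* `stub_flatBoundaryMatching : FlatBoundaryMatching` (research-open; the crux's own typed risk) — there is a
  universal real `C ≠ 0` such that for every flat-at-`b` configuration of the crux (same hypotheses, minus the
  interior edge) SOME interior reference edge sequence `(z_δ,w_δ) → z₀ ∈ D` has
  `midEdge(z_δ,w_δ) / exitTerm(b_δ) → C · exp((5/8) L z₀)`.  Intended witness: the first vertical edge above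
  `b + i r/2` on the normal through `b` inside the flat ball (nearest-site approximants, which lie in `Ω_δ`
  eventually by `JordanDomain.eventually_nearestSite_mem_meshDomain`), where the discrete domain is an exact
  discrete half-plane at every mesh and the comparison is with half-plane bridges/irreducible bridges
  (KennedyLawler2013 lattice-effect constant; LawlerSchrammWerner2004SAW §3.4).  This isolates the crux's
  "why it might fail": `C` may depend on more than the flat local environment at `b`.
* `ObservableLimitFlat_of` (kernel-checked, no `sorry`): `C` from stub B; given the crux's data, stub B supplies a
  reference sequence `z¹_δ → z₀¹` with `midEdge(z¹)/exit → C e^{(5/8)L z₀¹} ≠ 0`, stub A gives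
  `midEdge(z)/midEdge(z¹) → e^{(5/8)(L z₀ − L z₀¹)}`; the reference ratio is eventually non-zero, so
  `midEdge(z)/exit = (midEdge(z)/midEdge(z¹)) · (midEdge(z¹)/exit)` eventually, and the product of the limits is
  `C e^{(5/8) L z₀}` — concluding the crux BY NAME (its `let H` unfolds to the vocabulary definitionally).

Neither stub alone is the crux: A has no boundary term and no constant (probe `A → crux` fails), B speaks of ONE
interior sequence per configuration (probe `B → crux` fails; `∀` from `∃` is precisely A).  B is a consequence of
the crux up to exhibiting lattice approximants of one interior point; A restricted to flat-at-`b` domains is a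
consequence of the crux (quotient of two instances) — both are USED toward it (BC2 remark on consequences).
The route items r2 `AsymptoticMorera` / r3 `InteriorRegularity` are deliberately NOT aliased as stubs (they are
staffed as route cruxes; aliasing would double-staff them); the natural line for stub A on this route is
`AsymptoticMorera → InteriorRegularity → InteriorCovariance`.

## Disproof / negatives used
* `Cruxes/ObservableLimitFlat/Disproof.lean`: none exists (`ledger crux ls stmt-CriticalPhenomena-6855`: no
  workfiles at registration, 2026-08-17) — no `_false_without_` obstruction to honour.
* `ledger negatives --problem CriticalPhenomena` (11 entries, 2026-08-17): the relevant one is stmt-5420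
  `HexObservableLimit` (refuted-misstated, `SAWDefectDecoherenceHexObservableLimit_refuted`: a FREE discretisation
  `Λ_δ` lets a boundary corridor relocate the conformally effective root).  Both stubs, like the crux, use the
  CANONICAL discretisation `meshDomain` / `discreteDomainGraph` of `D.carrier` (largest mesh component, CHI closed
  edges): the discrete domain is a function of `(D, δ)`, no corridor can be carved, and for a Jordan domain the
  Euclidean root limit `δ a_δ → a` is the Carathéodory limit.  stmt-0772 (all-`δ` tightness), stmt-8261, stmt-8312
  are not touched (no tightness, no positivity/infinite-divisibility, no phase-retrieval stability is asserted).
* BC3 certificate (planner, 2026-08-17): `lean check --json` of this file rc 0, errors [], sorries 2 = the two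
  `stub_*`, zero elsewhere.  Probes `bc/<Stub>_{crux,summit}_probe.lean` (= §§1–2 of this file +
  `example : <Stub> → ObservableLimitFlat` resp. `→ _root_.SAWScalingLimit`
  `by first | exact? | simpa [<Stub>] | (unfold <Stub>; simpa) | aesop`, `maxHeartbeats 400000`): 4/4 FAIL (rc 1);
  split probes (each tactic its own `example`): 20/20 FAIL — `exact?` "could not close the goal", `aesop` "failed
  after exhaustive search", `simpa [·]` / `unfold ·; simpa` "assumption failed" on the unfolded implication,
  `unfold ·; aesop` heartbeat timeout.  No stub is cheaply the crux or the summit.  Vacuity pass in `Lines/birth.md`.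

Namespace `…Cruxes.ObservableLimitFlat.Birth`; statements over tree vocabulary only (`SAW.DomainSAW`,
`SAW.criticalFugacity`, `meshDomain`, `discreteDomainGraph`, `zdGraph`, `meshPoint`, `medialPoint`, `winding`,
`ConformalEquiv`, `ConformalEquiv.HasBoundaryValue`, `MarkedDomain.pt`).
-/

noncomputable section

open Filter Topology Set
open UpperHalfPlane (upperHalfPlaneSet)
open Literature.Probability.RandomPlanarGeometry Literature.Probability.LatticeModels

namespace Summit.CriticalPhenomena.SAWScalingLimit.Cruxes.ObservableLimitFlat.Birth

/-! ### 1. Vocabulary: the route's inlined observable, named -/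

/-- **The rooted half-edge term** `H_δ(p, q)` of the route (the `let H` of `ObservableLimitFlat`,
`AsymptoticMorera`, `InteriorRegularity`, letter for letter): the sum over self-avoiding walks `γ` of
`Ω_δ = discreteDomainGraph D.carrier δ` from the root `a δ` to the vertex `p` that have not used the edge `{p, q}`,
of `exp(−i (5/8) W) · x_c^{|γ|+1}`, where `W` is the winding of the mesh polyline started at the OUTSIDE reference
point `δ a′_δ` (fixed reference direction `a′_δ → a_δ` at the boundary root) and continued by the half-edge from
`δ p` to the midpoint of `{p, q}` (Duminil-Copin–Smirnov 2012, Def. 1, transposed to `δℤ²`; cf.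
`SAW.halfEdgeTerm`, which has no reference point). -/
def halfEdge (D : DobrushinDomain) (a a' : ℝ → Site 2) (δ : ℝ) (p q : Site 2) : ℂ :=
  ∑' γ : Literature.Probability.RandomPlanarGeometry.SAW.DomainSAW D.carrier δ (a δ) p, if s(p, q) ∈ γ.walk.edges then 0 else Complex.exp (-Complex.I * (5 / 8 : ℂ) * (Literature.Probability.LatticeModels.winding (Literature.Probability.LatticeModels.meshPoint δ (a' δ) :: (γ.walk.support.map (Literature.Probability.LatticeModels.meshPoint δ)) ++ [Literature.Probability.LatticeModels.medialPoint δ s(p, q)]) : ℝ)) * (Literature.Probability.RandomPlanarGeometry.SAW.criticalFugacity : ℂ) ^ (γ.length + 1)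

/-- **The rooted critical mid-edge parafermionic observable** at the edge `{z, w}` of `Ω_δ`: the sum of the two
half-edge terms (walks arriving at the midpoint from either endpoint), `σ = 5/8`, `x = x_c`. -/
def midEdge (D : DobrushinDomain) (a a' : ℝ → Site 2) (δ : ℝ) (z w : Site 2) : ℂ :=
  halfEdge D a a' δ z w + halfEdge D a a' δ w z

/-- **The boundary exit term at `b`**: walks from `a_δ` to the bottom-row vertex `b_δ`, continued by the
half-edge pointing straight down, out of the domain (`δ (b_δ − (0,1)) ∉ D`): the route's normalisation
`H_δ(b_δ, b_δ − (0,1))`. -/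
def exitTerm (D : DobrushinDomain) (a a' b : ℝ → Site 2) (δ : ℝ) : ℂ :=
  halfEdge D a a' δ (b δ) (b δ + ![0, -1])

/-! ### 2. The two stub statements -/

/-- STUB A statement — **interior conformal covariance (two-point interior form of DCS Conjecture 2 on `δℤ²`)**.
For every Dobrushin domain `D`, lattice roots `a_δ ∈ Ω_δ` with outside reference neighbour `a′_δ`
(`δ a′_δ ∉ D`), `δ a_δ → a = D.pt 0`, two edge sequences `(z_δ, w_δ)`, `(z′_δ, w′_δ)` of `Ω_δ` with
`δ z_δ → z₀ ∈ D`, `δ z′_δ → z₀′ ∈ D`, every conformal `Φ : D → ℍ` with `‖Φ‖ → ∞` at `a`, every gauge constant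
`c ≠ 0` and continuous `L` on `D` with `exp L = Φ′/c`:
`midEdge(z_δ, w_δ) / midEdge(z′_δ, w′_δ) → exp((5/8) (L z₀ − L z₀′))` as `δ → 0⁺`
(i.e. `→ (Φ′(z₀)/Φ′(z₀′))^{5/8}`, the branch being the one continuous along `D`; independent of the
normalisation of `Φ` at `∞`, of `c`, of the root's local lattice environment and of the reference direction, all
of which multiply both observables by the same factor).  The route header's "interior normalisation" target;
on this route the conclusion of `AsymptoticMorera → InteriorRegularity → ·` (Weyl + Riemann–Hilbert index-`5/8`
uniqueness).  Includes (for `z = z′`) the eventual non-vanishing of the interior observable and (across edge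
orientations) its isotropy, both asserted by the crux itself. -/
def InteriorCovariance : Prop :=
  ∀ (D : DobrushinDomain) (a a' z w z' w' : ℝ → Site 2) (z₀ z₀' : ℂ)
    (Φ : ConformalEquiv D.carrier upperHalfPlaneSet) (L : ℂ → ℂ) (c : ℂ),
    (∀ᶠ δ in 𝓝[>] (0 : ℝ), a δ ∈ meshDomain D.carrier δ ∧ (zdGraph 2).Adj (a δ) (a' δ) ∧
        meshPoint δ (a' δ) ∉ D.carrier ∧ (discreteDomainGraph D.carrier δ).Adj (z δ) (w δ) ∧
        (discreteDomainGraph D.carrier δ).Adj (z' δ) (w' δ)) →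
    Tendsto (fun δ => meshPoint δ (a δ)) (𝓝[>] (0 : ℝ)) (𝓝 (D.pt 0)) →
    z₀ ∈ D.carrier → Tendsto (fun δ => meshPoint δ (z δ)) (𝓝[>] (0 : ℝ)) (𝓝 z₀) →
    z₀' ∈ D.carrier → Tendsto (fun δ => meshPoint δ (z' δ)) (𝓝[>] (0 : ℝ)) (𝓝 z₀') →
    Tendsto (fun x => ‖Φ x‖) (𝓝[D.carrier] (D.pt 0)) atTop →
    c ≠ 0 → ContinuousOn L D.carrier → (∀ x ∈ D.carrier, Complex.exp (L x) = deriv Φ x / c) →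
    Tendsto (fun δ => midEdge D a a' δ (z δ) (w δ) / midEdge D a a' δ (z' δ) (w' δ)) (𝓝[>] (0 : ℝ))
      (𝓝 (Complex.exp ((5 / 8 : ℂ) * (L z₀ - L z₀'))))

/-- STUB B statement — **flat-boundary matching (the universal lattice constant at a flat boundary point)**.
There is a real `C ≠ 0` such that for every configuration of the crux WITHOUT its interior edge — Dobrushin
domain `D` flat near `b = D.pt 1` (`ball b r ∩ D = ball b r ∩ {im > im b}`), roots `a_δ → a` with outside
reference neighbour, bottom-row `b_δ → b` (`δ(b_δ − (0,1)) ∉ D`), conformal `Φ : D → ℍ` with `a ↦ ∞`, `b ↦ 0`,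
`Φ′ → c ≠ 0` at `b`, `L` a continuous log of `Φ′/c` on `D` with `L → 0` at `b` — there EXIST an edge sequence
`(z_δ, w_δ)` of `Ω_δ` (eventually) and a point `z₀ ∈ D` with `δ z_δ → z₀` such that
`midEdge(z_δ, w_δ) / exitTerm(b_δ) → C · exp((5/8) L z₀)`.
Intended witness: the vertical edge at the nearest site to `b + i r/2` (inside the flat ball, where `Ω_δ` is an
exact discrete half-plane at every mesh; nearest sites of interior points lie in `Ω_δ` eventually,
`JordanDomain.eventually_nearestSite_mem_meshDomain`).  The boundary half of the route's r4: the boundary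
layer at a flat `b` renormalises the exit term by a universal constant (KennedyLawler2013; half-plane bridge
decomposition, LawlerSchrammWerner2004SAW §3.4).  `∀` interior sequences from this `∃` is exactly stub A. -/
def FlatBoundaryMatching : Prop :=
  ∃ C : ℝ, C ≠ 0 ∧ ∀ (D : DobrushinDomain) (a a' b : ℝ → Site 2) (r : ℝ)
    (Φ : ConformalEquiv D.carrier upperHalfPlaneSet) (L : ℂ → ℂ) (c : ℂ),
    (∀ᶠ δ in 𝓝[>] (0 : ℝ), a δ ∈ meshDomain D.carrier δ ∧ (zdGraph 2).Adj (a δ) (a' δ) ∧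
        meshPoint δ (a' δ) ∉ D.carrier ∧ b δ ∈ meshDomain D.carrier δ ∧
        meshPoint δ (b δ + ![0, -1]) ∉ D.carrier) →
    Tendsto (fun δ => meshPoint δ (a δ)) (𝓝[>] (0 : ℝ)) (𝓝 (D.pt 0)) →
    Tendsto (fun δ => meshPoint δ (b δ)) (𝓝[>] (0 : ℝ)) (𝓝 (D.pt 1)) →
    0 < r → Metric.ball (D.pt 1) r ∩ D.carrier = Metric.ball (D.pt 1) r ∩ {ζ | (D.pt 1).im < ζ.im} →
    Tendsto (fun x => ‖Φ x‖) (𝓝[D.carrier] (D.pt 0)) atTop → Φ.HasBoundaryValue (D.pt 1) 0 →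
    c ≠ 0 → Tendsto (deriv Φ) (𝓝[D.carrier] (D.pt 1)) (𝓝 c) →
    ContinuousOn L D.carrier → (∀ x ∈ D.carrier, Complex.exp (L x) = deriv Φ x / c) →
    Tendsto L (𝓝[D.carrier] (D.pt 1)) (𝓝 0) →
    ∃ (z w : ℝ → Site 2) (z₀ : ℂ), z₀ ∈ D.carrier ∧
      (∀ᶠ δ in 𝓝[>] (0 : ℝ), (discreteDomainGraph D.carrier δ).Adj (z δ) (w δ)) ∧
      Tendsto (fun δ => meshPoint δ (z δ)) (𝓝[>] (0 : ℝ)) (𝓝 z₀) ∧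
      Tendsto (fun δ => midEdge D a a' δ (z δ) (w δ) / exitTerm D a a' b δ) (𝓝[>] (0 : ℝ))
        (𝓝 ((C : ℂ) * Complex.exp ((5 / 8 : ℂ) * L z₀)))

-- END OF STATEMENTS (the BC3 probe files copy the file up to this line)

/-! ### 3. The registered stubs (the only `sorry`s of the file) -/

/-- STUB A (research-open): interior conformal covariance of the rooted critical `ℤ²` parafermionic observable.
Why plausibly true: it is DCS Conjecture 2 with the boundary normalisation divided out — the root's lattice
factor and reference phase cancel between two interior edges, and interior edges of both orientations see the
same rotation-covariant limit `(Φ′)^{5/8}`; numerically the DCS identity holds asymptotically on `ℤ²` strips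
(BeatonGuttmannJensen2012).  Why it might fail: no discrete holomorphicity on `ℤ²`
(`not_hasExactVertexRelationZ2`), so holomorphy of subsequential limits is itself the route's rank-2 crux
`AsymptoticMorera`; isotropy across edge orientations is predicted only.  Intended line on this route:
`AsymptoticMorera → InteriorRegularity → InteriorCovariance` (Weyl lemma for the distributional `∂̄`,
boundary condition `arg F = −(5/8)·normal` ⇒ `Im(f dz^{5/8}) = 0`, RH uniqueness in the growth class at `a`). -/
theorem stub_interiorCovariance : InteriorCovariance := by
  sorry

/-- STUB B (research-open, carries the crux's typed risk): the flat-boundary matching constant.  Why plausibly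
true: inside the flat ball `Ω_δ` is an exact discrete half-plane at every mesh, the exit term at `b_δ` and the
mid-edge observable a fixed macroscopic distance up the normal differ by a boundary-layer factor that is a
HALF-PLANE quantity (bridge/irreducible-bridge decomposition of walks near a flat wall), hence universal; the
conformal factor `exp((5/8) L z₀) → 1` as `z₀ → b`.  Why it might fail (the crux's own): KennedyLawler2013 —
boundary lattice effects persist in SAW scaling limits, so `C` may depend on more than the flat local
environment (e.g. on the sub-lattice offset of the bottom row relative to `∂D`, which oscillates with `δ`
unless `im b ∈ δℤ` is arranged), or the ratio may fail to converge when `∂D` is rough near the root `a`. -/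
theorem stub_flatBoundaryMatching : FlatBoundaryMatching := by
  sorry

/-! ### Name-keyed aliases of the stub statements (hypotheses of the composition)

`Registered.stub_X : Prop` is the statement of `stub_X` under the registered stub's short name, so that the
skeleton audit (hypotheses admissible iff registered stubs BY NAME) accepts
`ObservableLimitFlat_of : Registered.stub_… → … → ObservableLimitFlat` (device of `Cruxes/ChainLaw/Lines/birth.lean`,
`Cruxes/DrivingIdentification/Lines/birth.lean`). -/
namespace Registered

/-- Alias keyed by the registered stub name. -/
abbrev stub_interiorCovariance : Prop := InteriorCovariance
/-- Alias keyed by the registered stub name. -/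
abbrev stub_flatBoundaryMatching : Prop := FlatBoundaryMatching

end Registered

/-! ### 4. The composition (kernel-checked, no `sorry`) -/

/-- **The two stubs imply the crux `ObservableLimitFlat` BY NAME.**  Take the universal constant `C` of stub B.
Given the crux's data `(D; a, a′, b; z, w → z₀; r; Φ, L, c)` and hypotheses: stub B provides one interior reference
edge sequence `(z¹_δ, w¹_δ) → z₀¹ ∈ D` with `midEdge(z¹)/exitTerm → C e^{(5/8) L z₀¹}` (`≠ 0`); stub A gives
`midEdge(z)/midEdge(z¹) → e^{(5/8)(L z₀ − L z₀¹)}`; the reference ratio is eventually non-zero, so eventually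
`midEdge(z)/exitTerm = (midEdge(z)/midEdge(z¹)) · (midEdge(z¹)/exitTerm)`, and the product of the limits is
`C e^{(5/8) L z₀}`.  The crux's inlined `let H` is the vocabulary `halfEdge` definitionally. -/
theorem ObservableLimitFlat_of (hA : Registered.stub_interiorCovariance)
    (hB : Registered.stub_flatBoundaryMatching) :
    Summit.CriticalPhenomena.SAWScalingLimit.Theses.SAWAsymptoticMorera.ObservableLimitFlat := by
  obtain ⟨C, hC, hB⟩ := hB
  refine ⟨C, hC, ?_⟩
  intro D a a' b z w z₀ r Φ L c
  -- inline the route's `let H` (zeta), so that the goal is stated over the raw sums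
  dsimp only
  intro hev ha hb hr hflat hz₀ hz hΦa hΦb hc hΦ' hL hexp hL0
  -- (B): the universal constant is matched along ONE interior reference edge sequence
  obtain ⟨z₁, w₁, z₁₀, hz₁₀, hadj₁, hz₁, hT₂⟩ := hB D a a' b r Φ L c
    (hev.mono fun δ h => ⟨h.1, h.2.1, h.2.2.1, h.2.2.2.1, h.2.2.2.2.1⟩)
    ha hb hr hflat hΦa hΦb hc hΦ' hL hexp hL0
  -- (A): interior covariance transports the matching to the given edge sequence
  have hT₁ : Tendsto (fun δ => midEdge D a a' δ (z δ) (w δ) / midEdge D a a' δ (z₁ δ) (w₁ δ))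
      (𝓝[>] (0 : ℝ)) (𝓝 (Complex.exp ((5 / 8 : ℂ) * (L z₀ - L z₁₀)))) :=
    hA D a a' z w z₁ w₁ z₀ z₁₀ Φ L c
      ((hev.and hadj₁).mono fun δ h => ⟨h.1.1, h.1.2.1, h.1.2.2.1, h.1.2.2.2.2.2, h.2⟩)
      ha hz₀ hz hz₁₀ hz₁ hΦa hc hL hexp
  -- the reference ratio is eventually non-zero, so the telescoping identity holds eventually
  have hK : (C : ℂ) * Complex.exp ((5 / 8 : ℂ) * L z₁₀) ≠ 0 :=
    mul_ne_zero (Complex.ofReal_ne_zero.2 hC) (Complex.exp_ne_zero _)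
  have hne : ∀ᶠ δ in 𝓝[>] (0 : ℝ), midEdge D a a' δ (z₁ δ) (w₁ δ) / exitTerm D a a' b δ ∈ {x : ℂ | x ≠ 0} :=
    hT₂.eventually (isOpen_ne.mem_nhds hK)
  have heq : (fun δ => midEdge D a a' δ (z δ) (w δ) / midEdge D a a' δ (z₁ δ) (w₁ δ) *
      (midEdge D a a' δ (z₁ δ) (w₁ δ) / exitTerm D a a' b δ)) =ᶠ[𝓝[>] (0 : ℝ)]
      fun δ => midEdge D a a' δ (z δ) (w δ) / exitTerm D a a' b δ := by
    filter_upwards [hne] with δ hδ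
    have h1 : midEdge D a a' δ (z₁ δ) (w₁ δ) ≠ 0 := (div_ne_zero_iff.1 hδ).1
    rw [div_mul_div_comm, mul_comm (midEdge D a a' δ (z₁ δ) (w₁ δ)) (exitTerm D a a' b δ),
      mul_div_mul_right _ _ h1]
  -- the product of the two limits is the claimed limit
  have key : Complex.exp ((5 / 8 : ℂ) * (L z₀ - L z₁₀)) * ((C : ℂ) * Complex.exp ((5 / 8 : ℂ) * L z₁₀)) =
      (C : ℂ) * Complex.exp ((5 / 8 : ℂ) * L z₀) := by
    rw [mul_sub, Complex.exp_sub, div_mul_eq_mul_div, div_eq_iff (Complex.exp_ne_zero _)]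
    ring
  have hT := hT₁.mul hT₂
  rw [key] at hT
  -- the goal is the route's raw expression; our vocabulary unfolds to it
  show Tendsto (fun δ => midEdge D a a' δ (z δ) (w δ) / exitTerm D a a' b δ) (𝓝[>] (0 : ℝ))
    (𝓝 ((C : ℂ) * Complex.exp ((5 / 8 : ℂ) * L z₀)))
  exact hT.congr' heq

/-- Wiring check: the registered stubs feed `ObservableLimitFlat_of` as stated. -/
example : Summit.CriticalPhenomena.SAWScalingLimit.Theses.SAWAsymptoticMorera.ObservableLimitFlat :=
  ObservableLimitFlat_of stub_interiorCovariance stub_flatBoundaryMatching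

end Summit.CriticalPhenomena.SAWScalingLimit.Cruxes.ObservableLimitFlat.Birth

end
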